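import Literature.Probability.Percolation.KSTPeriodicDefs
import HarnessLib

/-!
# KST-type RSW for periodic measures: the statements

Topic `Literature/Probability/Percolation`. Named statements (`def … : Prop`) for the steps of a
weak, constant form of the Russo–Seymour–Welsh theorem of Köhler-Schindler–Tassion
[KohlerSchindlerTassion2023, Theorem 1 with Comment 1] for `kℤ² ⋊ D₄`-periodic positively associated
bond measures on `ℤ²` (vocabulary: `KSTPeriodicDefs.lean`). They are proved one by one in the
files `KSTPeriodic*.lean`; the partition follows the paper:

* planar topology of lattice walks (folklore; all reduce to "a left–right and a top–bottom
  crossing of a rectangle meet", `exists_mem_support_of_crossing`): `ArchesMeet`,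
  `PartsToSegmentsMeet` (for Lemma 1), `PartsMeetMPath` (Lemma 5), `TopSideToLeftMeetsTB`,
  `TopSideToRightMeetsTB`, `AlternatingTBMeet` (Lemmas 3–4);
* planar duality for the arm event (§1 Duality, footnote 3): `ArmDuality`;
* Lemma 1(ii) (short crossings ⇒ arms, via the dual bridge variant): `ArmsOfShortCrossings`;
* Lemma 1(i),(iii) (bridges ⇒ long crossings, standard gluing): `BridgesGiveCrossings`;
* Lemma 3 (arms ⇒ quasi-crossings between adjacent scales): `QuasiOfArms`;
* Lemma 5 (closing): `ClosingIneq`; Lemma 4 (cascading): `CascadeStep`;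
* the weak periodic RSW theorem itself: `WeakPeriodicRSW`;
* (appended) the corridor lemma, Lemma 2, in the two orientations used: `CorridorA`, `CorridorB`.

Conventions. Scales are integers carrying the divisibility that makes every fraction of the paper
(`α = 1/64`, `β = 1/12`, `3β`, `5/2`, `31/8`, …) an integer and every translation a vector of
`kℤ²`; the quasi-crossing of scale `n` uses the big box `R_t(n + n/4 + k, n)` (margin
`3βn + k`, the extra `k` absorbing the parity offset `t` in Lemma 4) and `m`-paths of margin
`m/12`; the arm of scale `n` has target half-width `n/64`. All bounds are constants depending on
the displayed parameters only, uniform in the measure.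

## References

* [KohlerSchindlerTassion2023] L. Köhler-Schindler, V. Tassion, *Crossing probabilities for
  planar percolation*, Duke Math. J. 172 (2023) 809–838, arXiv:2011.04618, §1, §3–§5.
-/

namespace Literature.Probability.Percolation

open _root_.MeasureTheory LatticeModels

noncomputable section

namespace KSTPeriodic

/-! ### Planar topology of lattice walks -/

/-- **Interleaved arches meet.** Two lattice walks above the row `lo`, each with both endpoints on
that row, whose endpoints interleave (`a₀ < a'₀ < b₀ < b'₀`), have a common vertex. (Discrete
Jordan-curve fact behind the gluing of Fig. 6 of [KohlerSchindlerTassion2023].) [folklore] -/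
def ArchesMeet : Prop :=
  ∀ (lo : ℤ) (a b a' b' : Site 2) (P : (zdGraph 2).Walk a b) (Q : (zdGraph 2).Walk a' b'),
    (∀ z ∈ P.support, lo ≤ z 1) → (∀ z ∈ Q.support, lo ≤ z 1) →
    a 1 = lo → b 1 = lo → a' 1 = lo → b' 1 = lo → a 0 < a' 0 → a' 0 < b 0 → b 0 < b' 0 →
    ∃ z ∈ P.support, z ∈ Q.support

/-- **Crossed connections to the bottom segments meet.** In the rectangle `[L, R] × [B, T]` with
`L ≤ xl < xr ≤ R`: a walk from the left column or the top-left segment `{x₁ = T, x₀ ≤ xl}` to the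
bottom-right segment `{x₁ = B, xr ≤ x₀}` and a walk from the right column or the top-right segment
to the bottom-left segment have a common vertex (the case analysis `𝓔 ∩ v𝓔 ⊆ 𝓕` in the proof of
[KohlerSchindlerTassion2023, Lemma 1]). [folklore] -/
def PartsToSegmentsMeet : Prop :=
  ∀ (L R B T xl xr : ℤ) (p₁ b₁ p₂ b₂ : Site 2) (P₁ : (zdGraph 2).Walk p₁ b₁) (P₂ : (zdGraph 2).Walk p₂ b₂),
    L ≤ xl → xl < xr → xr ≤ R → B < T →
    (∀ z ∈ P₁.support, L ≤ z 0 ∧ z 0 ≤ R ∧ B ≤ z 1 ∧ z 1 ≤ T) →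
    (∀ z ∈ P₂.support, L ≤ z 0 ∧ z 0 ≤ R ∧ B ≤ z 1 ∧ z 1 ≤ T) →
    (p₁ 0 = L ∨ (p₁ 1 = T ∧ p₁ 0 ≤ xl)) → b₁ 1 = B → xr ≤ b₁ 0 →
    (p₂ 0 = R ∨ (p₂ 1 = T ∧ xr ≤ p₂ 0)) → b₂ 1 = B → b₂ 0 ≤ xl →
    ∃ z ∈ P₁.support, z ∈ P₂.support

/-- **A bridge meets every m-path.** In the rectangle `[L, R] × [B, T]` with `L ≤ xl ≤ xr ≤ R`: a
walk from the left part (left column, or top/bottom row with `x₀ ≤ xl`) to the right part (right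
column, or top/bottom row with `xr ≤ x₀`) and a walk from the upper target `{x₁ = T, xl ≤ x₀ ≤ xr}`
to the lower target `{x₁ = B, xl ≤ x₀ ≤ xr}` have a common vertex (the planar fact behind
[KohlerSchindlerTassion2023, Lemma 5]). [folklore] -/
def PartsMeetMPath : Prop :=
  ∀ (L R B T xl xr : ℤ) (p q u v : Site 2) (P : (zdGraph 2).Walk p q) (Q : (zdGraph 2).Walk u v),
    L ≤ xl → xl ≤ xr → xr ≤ R → B < T →
    (∀ z ∈ P.support, L ≤ z 0 ∧ z 0 ≤ R ∧ B ≤ z 1 ∧ z 1 ≤ T) →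
    (∀ z ∈ Q.support, L ≤ z 0 ∧ z 0 ≤ R ∧ B ≤ z 1 ∧ z 1 ≤ T) →
    (p 0 = L ∨ ((p 1 = T ∨ p 1 = B) ∧ p 0 ≤ xl)) →
    (q 0 = R ∨ ((q 1 = T ∨ q 1 = B) ∧ xr ≤ q 0)) →
    u 1 = T → xl ≤ u 0 → u 0 ≤ xr → v 1 = B → xl ≤ v 0 → v 0 ≤ xr →
    ∃ z ∈ P.support, z ∈ Q.support

/-- **A walk from the top side to the left side crosses a top–bottom walk started to its left.**
In `[L, R] × [B, T]`: if `γ` joins the top row to the bottom row and `σ` joins a top-row point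
strictly to the right of `γ`'s top endpoint to the left column, they have a common vertex.
[folklore] -/
def TopSideToLeftMeetsTB : Prop :=
  ∀ (L R B T : ℤ) (g₁ g₂ s f : Site 2) (γ : (zdGraph 2).Walk g₁ g₂) (σ : (zdGraph 2).Walk s f),
    B < T →
    (∀ z ∈ γ.support, L ≤ z 0 ∧ z 0 ≤ R ∧ B ≤ z 1 ∧ z 1 ≤ T) →
    (∀ z ∈ σ.support, L ≤ z 0 ∧ z 0 ≤ R ∧ B ≤ z 1 ∧ z 1 ≤ T) →
    g₁ 1 = T → g₂ 1 = B → s 1 = T → g₁ 0 < s 0 → f 0 = L →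
    ∃ z ∈ γ.support, z ∈ σ.support

/-- Mirror image of `TopSideToLeftMeetsTB`: `σ` starts strictly to the left of `γ`'s top endpoint
and reaches the right column. [folklore] -/
def TopSideToRightMeetsTB : Prop :=
  ∀ (L R B T : ℤ) (g₁ g₂ s f : Site 2) (γ : (zdGraph 2).Walk g₁ g₂) (σ : (zdGraph 2).Walk s f),
    B < T →
    (∀ z ∈ γ.support, L ≤ z 0 ∧ z 0 ≤ R ∧ B ≤ z 1 ∧ z 1 ≤ T) →
    (∀ z ∈ σ.support, L ≤ z 0 ∧ z 0 ≤ R ∧ B ≤ z 1 ∧ z 1 ≤ T) →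
    g₁ 1 = T → g₂ 1 = B → s 1 = T → s 0 < g₁ 0 → f 0 = R →
    ∃ z ∈ γ.support, z ∈ σ.support

/-- **Top–bottom walks with interleaved endpoints meet.** In `[L, R] × [B, T]`: two walks from the
top row to the bottom row whose top endpoints and bottom endpoints are in opposite orders have a
common vertex (both orientations). [folklore] -/
def AlternatingTBMeet : Prop :=
  ∀ (L R B T : ℤ) (g₁ g₂ s f : Site 2) (γ : (zdGraph 2).Walk g₁ g₂) (σ : (zdGraph 2).Walk s f),
    B < T →
    (∀ z ∈ γ.support, L ≤ z 0 ∧ z 0 ≤ R ∧ B ≤ z 1 ∧ z 1 ≤ T) →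
    (∀ z ∈ σ.support, L ≤ z 0 ∧ z 0 ≤ R ∧ B ≤ z 1 ∧ z 1 ≤ T) →
    g₁ 1 = T → g₂ 1 = B → s 1 = T → f 1 = B →
    ((s 0 < g₁ 0 ∧ g₂ 0 < f 0) ∨ (g₁ 0 < s 0 ∧ f 0 < g₂ 0)) →
    ∃ z ∈ γ.support, z ∈ σ.support

/-! ### Duality for the arm event -/

/-- **Arm / dual-bridge duality** ([KohlerSchindlerTassion2023, §1 Duality and footnote 3]): for a
lattice configuration `ω` and the rectangle `R = [x₁, x₂] × [y₁, y₂]` with targets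
`[u₁, u₂] × {y₂}` and `[u₁, u₂] × {y₁}` (`x₁ < u₁ < u₂ < x₂`, `y₁ < y₂`; for a one-column target both
alternatives can hold), EXACTLY ONE of the
following holds: the two targets are joined by an open path of `R`; or, in the dual configuration
of `ω ∩ E(R)` (faces labelled by lower-left corners, `dualConfig`, `Crossings.lean`), the left
group of faces (the column of faces left of `R`, and the faces above/below `R` abutting the top/
bottom side at abscissae `≤ u₁ - 1`) is joined to the right group (symmetric, abscissae `≥ u₂`)
through faces inside `R`. [cite: KohlerSchindlerTassion2023, §1 Duality] -/
def ArmDuality : Prop :=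
  ∀ (x₁ x₂ y₁ y₂ u₁ u₂ : ℤ), x₁ < u₁ → u₁ < u₂ → u₂ < x₂ → y₁ < y₂ →
    ∀ ω : BondConfig (Site 2), ω ⊆ (zdGraph 2).edgeSet →
      Xor (ω ∈ openCrossing {x : Site 2 | x₁ ≤ x 0 ∧ x 0 ≤ x₂ ∧ y₁ ≤ x 1 ∧ x 1 ≤ y₂}
              {x : Site 2 | u₁ ≤ x 0 ∧ x 0 ≤ u₂ ∧ x 1 = y₂} {x : Site 2 | u₁ ≤ x 0 ∧ x 0 ≤ u₂ ∧ x 1 = y₁})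
        (dualConfig (ω ∩ {e | ∀ z ∈ e, x₁ ≤ z 0 ∧ z 0 ≤ x₂ ∧ y₁ ≤ z 1 ∧ z 1 ≤ y₂}) ∈
          openCrossing
            ({f : Site 2 | x₁ ≤ f 0 ∧ f 0 ≤ x₂ - 1 ∧ y₁ ≤ f 1 ∧ f 1 ≤ y₂ - 1} ∪
              {f : Site 2 | (f 0 = x₁ - 1 ∧ y₁ - 1 ≤ f 1 ∧ f 1 ≤ y₂) ∨
                ((f 1 = y₂ ∨ f 1 = y₁ - 1) ∧ x₁ ≤ f 0 ∧ f 0 ≤ u₁ - 1)} ∪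
              {f : Site 2 | (f 0 = x₂ ∧ y₁ - 1 ≤ f 1 ∧ f 1 ≤ y₂) ∨
                ((f 1 = y₂ ∨ f 1 = y₁ - 1) ∧ u₂ ≤ f 0 ∧ f 0 ≤ x₂ - 1)})
            {f : Site 2 | (f 0 = x₁ - 1 ∧ y₁ - 1 ≤ f 1 ∧ f 1 ≤ y₂) ∨
              ((f 1 = y₂ ∨ f 1 = y₁ - 1) ∧ x₁ ≤ f 0 ∧ f 0 ≤ u₁ - 1)}
            {f : Site 2 | (f 0 = x₂ ∧ y₁ - 1 ≤ f 1 ∧ f 1 ≤ y₂) ∨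
              ((f 1 = y₂ ∨ f 1 = y₁ - 1) ∧ u₂ ≤ f 0 ∧ f 0 ≤ x₂ - 1)})

/-! ### The probabilistic steps -/

/-- `μ` is carried by lattice configurations (`ω ⊆ E(ℤ²)` almost surely) — needed for every
pathwise (planar) argument; automatic for images of product measures on `E(ℤ²)` and for planar
duals (`dualConfig ⊆ E(ℤ²)`). [folklore] -/
def LatticeCarried (μ : Measure (BondConfig (Site 2))) : Prop :=
  ∀ᵐ ω ∂μ, ω ⊆ (zdGraph 2).edgeSet

/-- **Lemma 1(ii), weak periodic form: short crossings give arms.** For every `ε > 0` and base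
scale `N₀` there are `a₀ > 0` and `N₁` such that every admissible measure whose short-way
crossings `𝓒_t(N, 8N)` have probability `≥ ε` at all scales `N ≥ N₀` divisible by `k` has arm
probability `≥ a₀` at every scale `n ≥ N₁` divisible by `64k` (target half-width `n/64`).
[cite: KohlerSchindlerTassion2023, Lemma 1(ii) and Comment 1] -/
def ArmsOfShortCrossings (k t : ℕ) : Prop :=
  ∀ ε : ℝ, 0 < ε → ∀ N₀ : ℕ, ∃ a₀ : ℝ, 0 < a₀ ∧ ∃ N₁ : ℕ,
    ∀ (μ : Measure (BondConfig (Site 2))) [IsProbabilityMeasure μ], Admissible k t μ → LatticeCarried μ →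
      (∀ N : ℕ, N₀ ≤ N → k ∣ N → ε ≤ μ.real (crossing t N (8 * N))) →
      ∀ n : ℕ, N₁ ≤ n → 64 * k ∣ n → a₀ ≤ μ.real (arm t (n / 64) n)

/-- **Lemma 1(i),(iii), weak periodic form: bridges give long crossings.** For every `b₀ > 0`
and aspect ratio `ρ ≥ 1` there is `c₀ > 0` such that for every admissible measure and every scale
`n ≥ 1` divisible by `768k`, a bridge probability `≥ b₀` at scale `n` (margin `n/12`) forces
`μ(𝓒_t(ρ n, n)) ≥ c₀`. [cite: KohlerSchindlerTassion2023, Lemma 1(i),(iii) and Comment 1] -/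
def BridgesGiveCrossings (k t : ℕ) : Prop :=
  ∀ b₀ : ℝ, 0 < b₀ → ∀ ρ : ℕ, 1 ≤ ρ → ∃ c₀ : ℝ, 0 < c₀ ∧
    ∀ (μ : Measure (BondConfig (Site 2))) [IsProbabilityMeasure μ], Admissible k t μ → LatticeCarried μ →
      ∀ n : ℕ, 1 ≤ n → 768 * k ∣ n → b₀ ≤ μ.real (bridge t (n / 12) n) →
        c₀ ≤ μ.real (crossing t (ρ * n) n)

/-- **Lemma 3, weak periodic form: arms give quasi-crossings between adjacent scales.** Arm bounds
`≥ a₀` at all scales `≥ N₁` divisible by `64k` give, for the scales `m ≥ N₂` divisible by `1536k`,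
`μ(𝓠(4m, m)) ≥ s₀` (big box `R_t(5m + k, 4m)`, `m`-paths of margin `m/12`).
[cite: KohlerSchindlerTassion2023, Lemma 3 and Comment 1] -/
def QuasiOfArms (k t : ℕ) : Prop :=
  ∀ a₀ : ℝ, 0 < a₀ → ∀ N₁ : ℕ, ∃ s₀ : ℝ, 0 < s₀ ∧ ∃ N₂ : ℕ,
    ∀ (μ : Measure (BondConfig (Site 2))) [IsProbabilityMeasure μ], Admissible k t μ → LatticeCarried μ →
      (∀ n : ℕ, N₁ ≤ n → 64 * k ∣ n → a₀ ≤ μ.real (arm t (n / 64) n)) →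
      ∀ m : ℕ, N₂ ≤ m → 1536 * k ∣ m → s₀ ≤ μ.real (quasi t (m + k) (4 * m) (m / 12) m)

/-- **Lemma 5 (closing), periodic form:** a quasi-crossing from scale `n` down to scale `m ≤ n`
closed by a bridge at scale `m` gives a bridge at scale `n`: `μ(𝓠(n, m)) · μ(𝓑(m)) ≤ μ(𝓑(n))`
(positive association). [cite: KohlerSchindlerTassion2023, Lemma 5 and Comment 1] -/
def ClosingIneq (k t : ℕ) : Prop :=
  ∀ (μ : Measure (BondConfig (Site 2))) [IsProbabilityMeasure μ], Admissible k t μ → LatticeCarried μ →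
    ∀ n m : ℕ, m ≤ n → 12 ∣ m → 12 ∣ n →
      μ.real (quasi t (n / 4 + k) n (m / 12) m) * μ.real (bridge t (m / 12) m) ≤
        μ.real (bridge t (n / 12) n)

/-- **Lemma 4 (cascading), periodic form:** for scales `j ≤ l ≤ m` (divisible by `12k`), with
`q(x, y) = μ(𝓠(x, y))`, `b(l) = μ(𝓑(l))` and `θ = 1 - √(1 - q(m, l))`: either `θ ≤ q(m, j)` or
`θ · q(l, j) ≤ 1 - (1 - b(l))²`. [cite: KohlerSchindlerTassion2023, Lemma 4 and Comment 1] -/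
def CascadeStep (k t : ℕ) : Prop :=
  ∀ (μ : Measure (BondConfig (Site 2))) [IsProbabilityMeasure μ], Admissible k t μ → LatticeCarried μ →
    ∀ m l j : ℕ, j ≤ l → l ≤ m → 12 * k ∣ j → 12 * k ∣ l → 12 * k ∣ m →
      (1 - Real.sqrt (1 - μ.real (quasi t (m / 4 + k) m (l / 12) l))) ≤
          μ.real (quasi t (m / 4 + k) m (j / 12) j) ∨
        (1 - Real.sqrt (1 - μ.real (quasi t (m / 4 + k) m (l / 12) l))) *
            μ.real (quasi t (l / 4 + k) l (j / 12) j) ≤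
          1 - (1 - μ.real (bridge t (l / 12) l)) ^ 2

/-- **The weak periodic RSW theorem** (constant form of [KohlerSchindlerTassion2023, Theorem 1]
under Comment 1): for `ε, p₀ > 0`, a base scale `N₀` and an integer aspect ratio `ρ ≥ 1` there
are `c > 0` and `N₁` such that every admissible probability measure whose short-way crossings
`𝓒_t(N, 8N)` have probability `≥ ε` at all scales `N ≥ N₀` divisible by `k`, and which has the
row finite-energy bound `μ(a given horizontal segment of length L on some row is open) ≥ p₀^L`,
crosses `R_t(ρN, N)` the long way with probability `≥ c` at every scale `N ≥ N₁`.
[cite: KohlerSchindlerTassion2023, Theorem 1 and Comment 1] -/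
def WeakPeriodicRSW (k t : ℕ) : Prop :=
  ∀ ε p₀ : ℝ, 0 < ε → 0 < p₀ → ∀ N₀ ρ : ℕ, 1 ≤ ρ → ∃ c : ℝ, 0 < c ∧ ∃ N₁ : ℕ,
    ∀ (μ : Measure (BondConfig (Site 2))) [IsProbabilityMeasure μ], Admissible k t μ → LatticeCarried μ →
      (∀ N : ℕ, N₀ ≤ N → k ∣ N → ε ≤ μ.real (crossing t N (8 * N))) →
      (∃ y : ℤ, ∀ (a : ℤ) (L : ℕ),
        p₀ ^ L ≤ μ.real {ω | ∀ i : ℕ, i < L → s(![a + i, y], ![a + i + 1, y]) ∈ ω}) →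
      ∀ N : ℕ, N₁ ≤ N → c ≤ μ.real (crossing t (ρ * N) N)

/-! ### The corridor lemma (Lemma 2) in the two orientations actually used

Added 2026-08-16 (append-only extension). Both are the discrete form of
[KohlerSchindlerTassion2023, Lemma 2 and Remark 1]: a crossing that avoids a "corridor with two
walls" must contain a corridor path. In the discrete statement "contains an `m`-path" is rendered
as "some walk inside `H` from the upper to the lower target uses only edges of the crossing"
(for a simple crossing this is a contiguous sub-path; the weaker form is what the cascade uses and
needs no simplicity). Proof route: `ArmDuality` applied to the edge set of the crossing gives a
face path across `H` crossing no edge of it, which must cross both walls (again `ArmDuality`);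
the winding number of the extended crossing is constant along the resulting primal/face chain but
differs at its two ends. -/

/-- **Corridor lemma, horizontal crosser** ([KohlerSchindlerTassion2023, Lemma 2 with Remark 1],
used in Lemma 3): in the box `T = [L, R] × [B₀, T₀]` let `χ` be a walk from the left column to
the right column, `H = [x₁, x₂] × [y₁, y₂] ⊆ T` a rectangle with targets `[u₁, u₂] × {y₂}`,
`[u₁, u₂] × {y₁}` (`x₁ < u₁ < u₂ < x₂`, `y₁ < y₂`), `γ₁, γ₂` walks inside `H` from the upper to
the lower target (the walls), `ζ₁` a walk in `T` from a vertex of `γ₁` to the top row of `T` and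
`ζ₂` a walk in `T` from a vertex of `γ₂` to the bottom row of `T`. If `χ` avoids
`γ₁ ∪ ζ₁ ∪ γ₂ ∪ ζ₂`, then some walk inside `H` from the upper target to the lower target uses only
edges of `χ`. [cite: KohlerSchindlerTassion2023, Lemma 2 and Remark 1] -/
def CorridorA : Prop :=
  ∀ (L R B₀ T₀ x₁ x₂ y₁ y₂ u₁ u₂ : ℤ), L ≤ x₁ → x₂ ≤ R → B₀ ≤ y₁ → y₂ ≤ T₀ →
    x₁ < u₁ → u₁ < u₂ → u₂ < x₂ → y₁ < y₂ →
    ∀ (a b : Site 2) (χ : (zdGraph 2).Walk a b),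
      (∀ z ∈ χ.support, L ≤ z 0 ∧ z 0 ≤ R ∧ B₀ ≤ z 1 ∧ z 1 ≤ T₀) → a 0 = L → b 0 = R →
    ∀ (g₁ h₁ : Site 2) (γ₁ : (zdGraph 2).Walk g₁ h₁),
      (∀ z ∈ γ₁.support, x₁ ≤ z 0 ∧ z 0 ≤ x₂ ∧ y₁ ≤ z 1 ∧ z 1 ≤ y₂) →
      (u₁ ≤ g₁ 0 ∧ g₁ 0 ≤ u₂ ∧ g₁ 1 = y₂) → (u₁ ≤ h₁ 0 ∧ h₁ 0 ≤ u₂ ∧ h₁ 1 = y₁) →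
    ∀ (c₁ d₁ : Site 2) (ζ₁ : (zdGraph 2).Walk c₁ d₁),
      (∀ z ∈ ζ₁.support, L ≤ z 0 ∧ z 0 ≤ R ∧ B₀ ≤ z 1 ∧ z 1 ≤ T₀) → c₁ ∈ γ₁.support → d₁ 1 = T₀ →
    ∀ (g₂ h₂ : Site 2) (γ₂ : (zdGraph 2).Walk g₂ h₂),
      (∀ z ∈ γ₂.support, x₁ ≤ z 0 ∧ z 0 ≤ x₂ ∧ y₁ ≤ z 1 ∧ z 1 ≤ y₂) →
      (u₁ ≤ g₂ 0 ∧ g₂ 0 ≤ u₂ ∧ g₂ 1 = y₂) → (u₁ ≤ h₂ 0 ∧ h₂ 0 ≤ u₂ ∧ h₂ 1 = y₁) →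
    ∀ (c₂ d₂ : Site 2) (ζ₂ : (zdGraph 2).Walk c₂ d₂),
      (∀ z ∈ ζ₂.support, L ≤ z 0 ∧ z 0 ≤ R ∧ B₀ ≤ z 1 ∧ z 1 ≤ T₀) → c₂ ∈ γ₂.support → d₂ 1 = B₀ →
    (∀ z ∈ χ.support, z ∉ γ₁.support ∧ z ∉ ζ₁.support ∧ z ∉ γ₂.support ∧ z ∉ ζ₂.support) →
    ∃ (p q : Site 2) (κ : (zdGraph 2).Walk p q),
      (u₁ ≤ p 0 ∧ p 0 ≤ u₂ ∧ p 1 = y₂) ∧ (u₁ ≤ q 0 ∧ q 0 ≤ u₂ ∧ q 1 = y₁) ∧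
      (∀ z ∈ κ.support, x₁ ≤ z 0 ∧ z 0 ≤ x₂ ∧ y₁ ≤ z 1 ∧ z 1 ≤ y₂) ∧ (∀ e ∈ κ.edges, e ∈ χ.edges)

/-- **Corridor lemma, vertical crosser** ([KohlerSchindlerTassion2023, Lemma 2], used in
Lemma 4): in the box `S = [L, R] × [B₀, T₀]` let `π` be a walk from the top row to the bottom
row, `H ⊆ S` a target rectangle as in `CorridorA`, `γ₁, γ₂` walls (walks inside `H` from the
upper to the lower target), `ζ₁` a walk in `S` from a vertex of `γ₁` to the LEFT column of `S`
and `ζ₂` a walk in `S` from a vertex of `γ₂` to the RIGHT column. If `π` avoids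
`γ₁ ∪ ζ₁ ∪ γ₂ ∪ ζ₂`, then some walk inside `H` from the upper target to the lower target uses only
edges of `π`. [cite: KohlerSchindlerTassion2023, Lemma 2] -/
def CorridorB : Prop :=
  ∀ (L R B₀ T₀ x₁ x₂ y₁ y₂ u₁ u₂ : ℤ), L ≤ x₁ → x₂ ≤ R → B₀ ≤ y₁ → y₂ ≤ T₀ →
    x₁ < u₁ → u₁ < u₂ → u₂ < x₂ → y₁ < y₂ →
    ∀ (a b : Site 2) (π : (zdGraph 2).Walk a b),
      (∀ z ∈ π.support, L ≤ z 0 ∧ z 0 ≤ R ∧ B₀ ≤ z 1 ∧ z 1 ≤ T₀) → a 1 = T₀ → b 1 = B₀ →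
    ∀ (g₁ h₁ : Site 2) (γ₁ : (zdGraph 2).Walk g₁ h₁),
      (∀ z ∈ γ₁.support, x₁ ≤ z 0 ∧ z 0 ≤ x₂ ∧ y₁ ≤ z 1 ∧ z 1 ≤ y₂) →
      (u₁ ≤ g₁ 0 ∧ g₁ 0 ≤ u₂ ∧ g₁ 1 = y₂) → (u₁ ≤ h₁ 0 ∧ h₁ 0 ≤ u₂ ∧ h₁ 1 = y₁) →
    ∀ (c₁ d₁ : Site 2) (ζ₁ : (zdGraph 2).Walk c₁ d₁),
      (∀ z ∈ ζ₁.support, L ≤ z 0 ∧ z 0 ≤ R ∧ B₀ ≤ z 1 ∧ z 1 ≤ T₀) → c₁ ∈ γ₁.support → d₁ 0 = L →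
    ∀ (g₂ h₂ : Site 2) (γ₂ : (zdGraph 2).Walk g₂ h₂),
      (∀ z ∈ γ₂.support, x₁ ≤ z 0 ∧ z 0 ≤ x₂ ∧ y₁ ≤ z 1 ∧ z 1 ≤ y₂) →
      (u₁ ≤ g₂ 0 ∧ g₂ 0 ≤ u₂ ∧ g₂ 1 = y₂) → (u₁ ≤ h₂ 0 ∧ h₂ 0 ≤ u₂ ∧ h₂ 1 = y₁) →
    ∀ (c₂ d₂ : Site 2) (ζ₂ : (zdGraph 2).Walk c₂ d₂),
      (∀ z ∈ ζ₂.support, L ≤ z 0 ∧ z 0 ≤ R ∧ B₀ ≤ z 1 ∧ z 1 ≤ T₀) → c₂ ∈ γ₂.support → d₂ 0 = R →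
    (∀ z ∈ π.support, z ∉ γ₁.support ∧ z ∉ ζ₁.support ∧ z ∉ γ₂.support ∧ z ∉ ζ₂.support) →
    ∃ (p q : Site 2) (κ : (zdGraph 2).Walk p q),
      (u₁ ≤ p 0 ∧ p 0 ≤ u₂ ∧ p 1 = y₂) ∧ (u₁ ≤ q 0 ∧ q 0 ≤ u₂ ∧ q 1 = y₁) ∧
      (∀ z ∈ κ.support, x₁ ≤ z 0 ∧ z 0 ≤ x₂ ∧ y₁ ≤ z 1 ∧ z 1 ≤ y₂) ∧ (∀ e ∈ κ.edges, e ∈ π.edges)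

/-! ### The cascading step at positive scales

Added 2026-08-16 (append-only extension). `CascadeStep` above also quantifies over the bottom
scale `j = 0`, where the `j`-paths degenerate (the region `H = R_t(0, 0)` has its targets on its
own corners, so the corridor lemma `CorridorB` — which needs targets strictly inside the top and
bottom sides — does not apply, and for `t = 0` an `l`-path never "contains" the one-point
`0`-path); the cascade (`weakPeriodicRSW_of`) only ever uses scales `M₀ 4ⁱ ≥ 1`. The following
variant records exactly the positive-scale statement that Lemma 4 proves. -/

/-- **Lemma 4 (cascading), periodic form, positive scales:** for scales `1 ≤ j ≤ l ≤ m` divisible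
by `12k`, with `q(x, y) = μ(𝓠(x, y))`, `b(l) = μ(𝓑(l))` and `θ = 1 - √(1 - q(m, l))`: either
`θ ≤ q(m, j)` or `θ · q(l, j) ≤ 1 - (1 - b(l))²` (`CascadeStep` restricted to `0 < j`).
[cite: KohlerSchindlerTassion2023, Lemma 4 and Comment 1] -/
def CascadeStepPos (k t : ℕ) : Prop :=
  ∀ (μ : Measure (BondConfig (Site 2))) [IsProbabilityMeasure μ], Admissible k t μ → LatticeCarried μ →
    ∀ m l j : ℕ, 0 < j → j ≤ l → l ≤ m → 12 * k ∣ j → 12 * k ∣ l → 12 * k ∣ m →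
      (1 - Real.sqrt (1 - μ.real (quasi t (m / 4 + k) m (l / 12) l))) ≤
          μ.real (quasi t (m / 4 + k) m (j / 12) j) ∨
        (1 - Real.sqrt (1 - μ.real (quasi t (m / 4 + k) m (l / 12) l))) *
            μ.real (quasi t (l / 4 + k) l (j / 12) j) ≤
          1 - (1 - μ.real (bridge t (l / 12) l)) ^ 2

/-- `CascadeStep` implies its positive-scale restriction. [folklore] -/
theorem cascadeStepPos_of_cascadeStep {k t : ℕ} (h : CascadeStep k t) : CascadeStepPos k t :=
  fun μ _ hμ hL m l j _ hjl hlm hj hl hm => h μ hμ hL m l j hjl hlm hj hl hm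

end KSTPeriodic

end

end Literature.Probability.Percolation
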